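import Mathlib.Topology.UniformSpace.UniformApproximation
import Mathlib.Topology.UniformSpace.LocallyUniformConvergence
import Mathlib.Topology.EMetricSpace.Lipschitz
import Mathlib.Analysis.Calculus.MeanValue
import Mathlib.Analysis.Calculus.ContDiff.Basic
import Mathlib.Analysis.SpecialFunctions.Pow.Continuity
import Literature.Geometry.Lorentzian.CoordCurvature
import HarnessLib

/-!
# Burnett's high-frequency convergence of metrics in a chart (Burnett 1989; Huneau–Luk 2019/2024)

The convergence notion behind **Burnett's conjecture** (Burnett, J. Math. Phys. 30 (1989) 90;
Huneau–Luk, arXiv:1907.10743 §1 and §4; arXiv:2403.03470 Assumptions 1.2; survey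
Class. Quantum Grav. 41 (2024) 143002, §1 (1.3)): a sequence of Lorentzian metrics `gₙ`, given
by their components in a fixed chart `U ⊆ ℝ^{d+1}`, converges to `g₀` uniformly on compact sets
while the first derivatives stay bounded (so `∂gₙ ⇀* ∂g₀` only weakly-*): the limit of vacuum
metrics need not be vacuum, and the conjecture says it is Einstein–massless-Vlasov.

Everything is stated for maps `g : ℕ → E → F` between real normed spaces (the metric components
`E4 → (E4 →L[ℝ] E4 →L[ℝ] ℝ)` of `KerrConvergence.lean` are the intended instance; nothing here
uses the Lorentzian signature, which enters through `MetricCoord.IsMetricOn` when needed).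

* `IsFrequencyScale lam` — a decreasing sequence `λₙ ∈ (0, 1)`, `λₙ → 0`
  (HL 2024, Assumptions 1.2 (2)).
* `BurnettConverges U g g₀` — **Burnett's hypotheses** in the form the route
  `FinalStateConjecture/BurnettKineticRigidity` needs them (Lipschitz limits, no frequency
  scale): `gₙ → g₀` locally uniformly on `U` and the `gₙ` are *equi-locally-Lipschitz* on `U`
  (every point of `U` has a relative neighbourhood on which all `gₙ` are `C`-Lipschitz with one
  `C`), the `W^{1,∞}_{loc}` form of Burnett's "`gᵢ(λ) → g` uniformly on compact sets with
  `sup |∇g(λ)| < ∞`" (HL 2024, Remark 1.3; HL 2019, §4 hypotheses (3) and (5) for `k ≤ 1`).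
  API: restriction (`mono`), subsequences (`comp_strictMono`), continuity of the `gₙ` and of the
  limit, and **the limit is locally Lipschitz** (`locallyLipschitzOn_limit`).
* `BurnettConvergesAtScale U g g₀ lam` — the **fixed-frequency-scale** version of
  Huneau–Luk 2024, Assumptions 1.2 (2)–(3) (= the survey's (1.3) with `K = 2`):
  `|gₙ − g₀| ≤ λₙ`, `|∂gₙ| ≲ 1`, `|∂²gₙ| ≲ λₙ⁻¹` uniformly on `U`; it implies `BurnettConverges`
  on an open `U` (`BurnettConvergesAtScale.burnettConverges`, HL 2024 Remark 1.3).
* `MetricCoord.waveGauge G b x k = (G⁻¹)^{ij} Γᵏ_{ij}` — the contracted Christoffel symbols of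
  metric components `G` in the basis (= chart) `b` (HL 2024, (1.3)), over the coordinate tensor
  calculus of `CoordCurvature.lean` (`ginv`, `chrAt`), and `WaveCoordinateCondition` — the
  **generalised wave coordinate condition** (1.4) of HL 2024: `|Hₙ − H₀| ≲ λₙ^η`, `|∂Hₙ| ≲ 1`.

The microlocal defect measure of such a sequence (HL 2024, Def. 4.1, (1.5)) is in
`BurnettDefectMeasure.lean`.

## Design / what is NOT here

* No smoothness is built into `BurnettConverges` (Burnett limits are only Lipschitz; a
  Lipschitz `g₀` is exactly the thin-shell regime the route must allow); `BurnettConvergesAtScale`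
  asks `gₙ ∈ C²(U)` so that `fderiv`/`iteratedFDeriv ℝ 2` are the honest derivatives on the open
  set `U` (HL 2024 assume `C^∞` metrics `gₙ, g₀`; smoothness, symmetry and non-degeneracy of the
  components are the separate predicate `MetricCoord.IsMetricOn`). Only open `U` are intended.
* Weak-* convergence `∂gₙ ⇀* ∂g₀` is automatic (distributional convergence plus boundedness) and
  is not a field; the vacuum equations, the gauge and the identification of the limit are
  hypotheses/conclusions of the theorems (HL 2024, Thm. 1.5), not part of the convergence notion.
* HL 2019 let the scale `λₙ` depend on the compact set `K ⊆ U`; the global-on-`U` form of HL 2024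
  (bounded `U`) is recorded, the local one being its restriction to precompact open subsets
  (`BurnettConvergesAtScale.mono`).
* Burnett's own paper is paywalled (acquisition request acq-02888); his hypotheses are quoted from
  HL 2024, Conjecture 1.1 / Remark 1.3 and the survey, §1.

## References

* G. A. Burnett, *The high-frequency limit in general relativity*, J. Math. Phys. 30 (1989)
  90–96. [Burnett1989]
* C. Huneau, J. Luk, *Burnett's conjecture in generalized wave coordinates*, arXiv:2403.03470,
  Assumptions 1.2, Remark 1.3, Definition 1.4, Theorem 1.5. [HuneauLuk2024wave]
* C. Huneau, J. Luk, *Trilinear compensated compactness and Burnett's conjecture in general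
  relativity*, Ann. Sci. ÉNS (2024), arXiv:1907.10743, §1, §4. [HuneauLuk2024trilinear]
* C. Huneau, J. Luk, *High-frequency solutions to the Einstein equations*, Class. Quantum
  Grav. 41 (2024) 143002, §1 (1.3), §4. [HuneauLuk2024survey]
-/

noncomputable section

open Set Filter Topology Metric
open scoped NNReal Topology ContDiff

namespace Literature.Geometry.Lorentzian

/-! ### Frequency scales -/

/-- A **frequency scale**: a (weakly) decreasing sequence `λₙ ∈ (0, 1)` with `λₙ → 0`
(Huneau–Luk 2024, Assumptions 1.2 (2): "a decreasing sequence `{λₙ} ⊂ (0, 1)` with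
`lim λₙ = 0`"; HL 2019 §4 (5) asks only `λₙ ∈ (0, 1]`, `λₙ → 0`). The wavelength of the
oscillations of `gₙ − g₀`. [cite: HuneauLuk2024wave, Assumptions 1.2 (2)] -/
structure IsFrequencyScale (lam : ℕ → ℝ) : Prop where
  /-- `0 < λₙ < 1`. -/
  mem_Ioo : ∀ n, lam n ∈ Ioo (0 : ℝ) 1
  /-- `λₙ` is (weakly) decreasing. -/
  antitone : Antitone lam
  /-- `λₙ → 0`. -/
  tendsto_zero : Tendsto lam atTop (𝓝 0)

namespace IsFrequencyScale

variable {lam : ℕ → ℝ}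

/-- `0 < λₙ` (HL 2024, Assumptions 1.2 (2)). [cite: HuneauLuk2024wave, Assumptions 1.2 (2)] -/
theorem pos (h : IsFrequencyScale lam) (n : ℕ) : 0 < lam n := (h.mem_Ioo n).1

/-- `λₙ < 1` (HL 2024, Assumptions 1.2 (2)). [cite: HuneauLuk2024wave, Assumptions 1.2 (2)] -/
theorem lt_one (h : IsFrequencyScale lam) (n : ℕ) : lam n < 1 := (h.mem_Ioo n).2

/-- `1 ≤ λₙ⁻¹`: the bound `|∂²gₙ| ≲ λₙ⁻¹` is never better than `≲ 1`
(HL 2024, Assumptions 1.2 (2)–(3)). [cite: HuneauLuk2024wave, Assumptions 1.2 (2)] -/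
theorem one_le_inv (h : IsFrequencyScale lam) (n : ℕ) : 1 ≤ (lam n)⁻¹ :=
  (one_le_inv₀ (h.pos n)).2 (h.lt_one n).le

/-- A subsequence of a frequency scale is a frequency scale (passing to subsequences is how the
defect measures of HL 2024, Def. 4.1 are obtained). [cite: HuneauLuk2024wave, Definition 4.1] -/
theorem comp_strictMono (h : IsFrequencyScale lam) {φ : ℕ → ℕ} (hφ : StrictMono φ) :
    IsFrequencyScale (lam ∘ φ) where
  mem_Ioo n := h.mem_Ioo (φ n)
  antitone := h.antitone.comp_monotone hφ.monotone
  tendsto_zero := h.tendsto_zero.comp hφ.tendsto_atTop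

end IsFrequencyScale

/-! ### Burnett convergence: locally uniform, equi-locally-Lipschitz -/

section Generic

variable {E F : Type*} [NormedAddCommGroup E] [NormedAddCommGroup F]

/-- **Burnett convergence** of a sequence of maps `gₙ : E → F` to `g₀` on `U ⊆ E` (the metric
components in a chart): `gₙ → g₀` locally uniformly on `U`, and the `gₙ` are
**equi-locally-Lipschitz** on `U` — every `x ∈ U` has a neighbourhood `t ∈ 𝓝[U] x` and a
constant `C` with `gₙ` `C`-Lipschitz on `t` for *all* `n` (uniform local `W^{1,∞}` bound). This is
Burnett's hypothesis "`g(λ) → g` uniformly on compact sets and `sup |∂g(λ)| < ∞`" (Burnett 1989;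
quoted in Huneau–Luk 2024, Conjecture 1.1 and Remark 1.3: "the original conjecture only requires
`supₙ |∂gₙ| < ∞`"; HL 2019, §4 (3), (5) with `k ≤ 1`) in the `W^{1,∞}_{loc}` form which makes
sense for Lipschitz metrics; then `g₀` is locally Lipschitz (`locallyLipschitzOn_limit`) and
`∂gₙ ⇀* ∂g₀`. Only open `U` are intended. [cite: HuneauLuk2024wave, Remark 1.3] -/
structure BurnettConverges (U : Set E) (g : ℕ → E → F) (g₀ : E → F) : Prop where
  /-- `gₙ → g₀` locally uniformly on `U`. -/
  tendstoLocallyUniformlyOn : TendstoLocallyUniformlyOn g g₀ atTop U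
  /-- The `gₙ` are equi-locally-Lipschitz on `U`: `sup_n ‖gₙ‖_{W^{1,∞}} < ∞` locally. -/
  equiLipschitz : ∀ x ∈ U, ∃ C : ℝ≥0, ∃ t ∈ 𝓝[U] x, ∀ n, LipschitzOnWith C (g n) t

namespace BurnettConverges

variable {U V : Set E} {g : ℕ → E → F} {g₀ : E → F}

/-- Burnett convergence restricts to subsets (HL 2019, §4.1 "reduction to compact sets").
[cite: HuneauLuk2024trilinear, §4.1] -/
theorem mono (h : BurnettConverges U g g₀) (hV : V ⊆ U) : BurnettConverges V g g₀ where
  tendstoLocallyUniformlyOn := h.tendstoLocallyUniformlyOn.mono hV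
  equiLipschitz x hx := by
    obtain ⟨C, t, ht, hL⟩ := h.equiLipschitz x (hV hx)
    exact ⟨C, t, nhdsWithin_mono x hV ht, hL⟩

/-- Burnett convergence passes to subsequences (as needed to extract defect measures,
HL 2024, Def. 4.1). [cite: HuneauLuk2024wave, Definition 4.1] -/
theorem comp_strictMono (h : BurnettConverges U g g₀) {φ : ℕ → ℕ} (hφ : StrictMono φ) :
    BurnettConverges U (g ∘ φ) g₀ where
  tendstoLocallyUniformlyOn u hu x hx := by
    obtain ⟨t, ht, H⟩ := h.tendstoLocallyUniformlyOn u hu x hx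
    exact ⟨t, ht, hφ.tendsto_atTop.eventually H⟩
  equiLipschitz x hx := by
    obtain ⟨C, t, ht, hL⟩ := h.equiLipschitz x hx
    exact ⟨C, t, ht, fun n ↦ hL (φ n)⟩

/-- Each `gₙ` of a Burnett-convergent sequence is continuous on `U` (it is locally Lipschitz
there). [cite: HuneauLuk2024wave, Remark 1.3] -/
theorem continuousOn (h : BurnettConverges U g g₀) (n : ℕ) : ContinuousOn (g n) U := by
  intro x hx
  obtain ⟨C, t, ht, hL⟩ := h.equiLipschitz x hx
  exact ((hL n).continuousOn.continuousWithinAt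
    (mem_of_mem_nhdsWithin hx ht)).mono_of_mem_nhdsWithin ht

/-- Pointwise convergence `gₙ(x) → g₀(x)` on `U`. [cite: HuneauLuk2024wave, Assumptions 1.2 (2)] -/
theorem tendsto (h : BurnettConverges U g g₀) {x : E} (hx : x ∈ U) :
    Tendsto (fun n ↦ g n x) atTop (𝓝 (g₀ x)) :=
  h.tendstoLocallyUniformlyOn.tendsto_at hx

/-- **The Burnett limit is continuous** on `U` (locally uniform limit of continuous maps).
[cite: HuneauLuk2024wave, Remark 1.3] -/
theorem continuousOn_limit (h : BurnettConverges U g g₀) : ContinuousOn g₀ U :=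
  h.tendstoLocallyUniformlyOn.continuousOn (Eventually.of_forall h.continuousOn).frequently

/-- **The Burnett limit is locally Lipschitz** on `U`, with the same local constants as the
sequence: a pointwise limit of `C`-Lipschitz maps is `C`-Lipschitz (this is why Burnett limits
are Lipschitz Lorentzian metrics; HL 2019, §1: "`h₀` … `∂hₙ → ∂h₀` weakly").
[cite: HuneauLuk2024trilinear, §1] -/
theorem exists_lipschitzOnWith_limit (h : BurnettConverges U g g₀) {x : E} (hx : x ∈ U) :
    ∃ C : ℝ≥0, ∃ t ∈ 𝓝[U] x, LipschitzOnWith C g₀ t ∧ ∀ n, LipschitzOnWith C (g n) t := by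
  obtain ⟨C, t, ht, hL⟩ := h.equiLipschitz x hx
  refine ⟨C, t ∩ U, inter_mem ht self_mem_nhdsWithin, ?_, fun n ↦ (hL n).mono inter_subset_left⟩
  refine LipschitzOnWith.of_dist_le_mul fun y hy z hz ↦ ?_
  have hlim : Tendsto (fun n ↦ dist (g n y) (g n z)) atTop (𝓝 (dist (g₀ y) (g₀ z))) :=
    (h.tendsto hy.2).dist (h.tendsto hz.2)
  exact le_of_tendsto' hlim fun n ↦ (hL n).dist_le_mul y hy.1 z hz.1

/-- The Burnett limit is locally Lipschitz on `U` (Mathlib's `LocallyLipschitzOn`).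
[cite: HuneauLuk2024trilinear, §1] -/
theorem locallyLipschitzOn_limit (h : BurnettConverges U g g₀) : LocallyLipschitzOn U g₀ := by
  intro x hx
  obtain ⟨C, t, ht, hL, -⟩ := h.exists_lipschitzOnWith_limit hx
  exact ⟨C, t, ht, hL⟩

end BurnettConverges

/-! ### The fixed-frequency-scale version (Huneau–Luk 2024, Assumptions 1.2 (2)–(3)) -/

variable [NormedSpace ℝ E] [NormedSpace ℝ F]

/-- **High-frequency convergence at the frequency scale `λₙ`** (Huneau–Luk 2024,
Assumptions 1.2 (2)–(3); the survey's (1.3) `|∂ᵏ(gᵢ − g₀)| ≲ λᵢ^{1−k}`, `k ≤ 2`): `λₙ` is a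
frequency scale, the `gₙ` are `C²` on `U`, and uniformly on `U`
`‖gₙ(x) − g₀(x)‖ ≤ λₙ` ((1.1), no constant), `‖Dgₙ(x)‖ ≤ C` and `‖D²gₙ(x)‖ ≤ C λₙ⁻¹` ((1.2),
`C` independent of `n`). HL assume moreover `gₙ, g₀ ∈ C^∞` and `U` bounded; those, the vacuum
equations (1) and the gauge condition (4) (`WaveCoordinateCondition`) are kept separate. Only open
`U` are intended (then `fderiv`, `iteratedFDeriv ℝ 2` are the classical derivatives).
[cite: HuneauLuk2024wave, Assumptions 1.2 (2)-(3)] -/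
structure BurnettConvergesAtScale (U : Set E) (g : ℕ → E → F) (g₀ : E → F) (lam : ℕ → ℝ) :
    Prop where
  /-- `λₙ ↓ 0` in `(0, 1)`. -/
  isFrequencyScale : IsFrequencyScale lam
  /-- The `gₙ` are `C²` on `U`. -/
  contDiffOn : ∀ n, ContDiffOn ℝ 2 (g n) U
  /-- (1.1): `|gₙ − g₀| ≤ λₙ` on `U`. -/
  norm_sub_le : ∀ n, ∀ x ∈ U, ‖g n x - g₀ x‖ ≤ lam n
  /-- (1.2), first half: `|∂gₙ| ≲ 1` on `U`. -/
  exists_norm_fderiv_le : ∃ C : ℝ, ∀ n, ∀ x ∈ U, ‖fderiv ℝ (g n) x‖ ≤ C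
  /-- (1.2), second half: `|∂²gₙ| ≲ λₙ⁻¹` on `U`. -/
  exists_norm_iteratedFDeriv_two_le :
    ∃ C : ℝ, ∀ n, ∀ x ∈ U, ‖iteratedFDeriv ℝ 2 (g n) x‖ ≤ C * (lam n)⁻¹

namespace BurnettConvergesAtScale

variable {U V : Set E} {g : ℕ → E → F} {g₀ : E → F} {lam : ℕ → ℝ}

/-- Restriction to a subset (HL 2019, §4 (5): the bounds on compact subsets).
[cite: HuneauLuk2024trilinear, §4 (5)] -/
theorem mono (h : BurnettConvergesAtScale U g g₀ lam) (hV : V ⊆ U) :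
    BurnettConvergesAtScale V g g₀ lam where
  isFrequencyScale := h.isFrequencyScale
  contDiffOn n := (h.contDiffOn n).mono hV
  norm_sub_le n x hx := h.norm_sub_le n x (hV hx)
  exists_norm_fderiv_le := by
    obtain ⟨C, hC⟩ := h.exists_norm_fderiv_le
    exact ⟨C, fun n x hx ↦ hC n x (hV hx)⟩
  exists_norm_iteratedFDeriv_two_le := by
    obtain ⟨C, hC⟩ := h.exists_norm_iteratedFDeriv_two_le
    exact ⟨C, fun n x hx ↦ hC n x (hV hx)⟩

/-- Passing to a subsequence (HL 2024, Def. 4.1: the defect measures are limits along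
subsequences). [cite: HuneauLuk2024wave, Definition 4.1] -/
theorem comp_strictMono (h : BurnettConvergesAtScale U g g₀ lam) {φ : ℕ → ℕ}
    (hφ : StrictMono φ) : BurnettConvergesAtScale U (g ∘ φ) g₀ (lam ∘ φ) where
  isFrequencyScale := h.isFrequencyScale.comp_strictMono hφ
  contDiffOn n := h.contDiffOn (φ n)
  norm_sub_le n x hx := h.norm_sub_le (φ n) x hx
  exists_norm_fderiv_le := by
    obtain ⟨C, hC⟩ := h.exists_norm_fderiv_le
    exact ⟨C, fun n x hx ↦ hC (φ n) x hx⟩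
  exists_norm_iteratedFDeriv_two_le := by
    obtain ⟨C, hC⟩ := h.exists_norm_iteratedFDeriv_two_le
    exact ⟨C, fun n x hx ↦ hC (φ n) x hx⟩

/-- (1.1) gives **uniform** convergence on `U`: `sup_U ‖gₙ − g₀‖ ≤ λₙ → 0`.
[cite: HuneauLuk2024wave, Assumptions 1.2 (2)] -/
theorem tendstoUniformlyOn (h : BurnettConvergesAtScale U g g₀ lam) :
    TendstoUniformlyOn g g₀ atTop U := by
  refine Metric.tendstoUniformlyOn_iff.2 fun ε hε ↦ ?_
  filter_upwards [h.isFrequencyScale.tendsto_zero.eventually (gt_mem_nhds hε)] with n hn x hx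
  rw [dist_comm, dist_eq_norm]
  exact (h.norm_sub_le n x hx).trans_lt hn

/-- Each `gₙ` is differentiable at the points of an open `U`.
[cite: HuneauLuk2024wave, Assumptions 1.2] -/
theorem differentiableAt (h : BurnettConvergesAtScale U g g₀ lam) (hU : IsOpen U) (n : ℕ)
    {x : E} (hx : x ∈ U) : DifferentiableAt ℝ (g n) x :=
  ((h.contDiffOn n).differentiableOn (by simp) x hx).differentiableAt (hU.mem_nhds hx)

/-- **Huneau–Luk's hypotheses imply Burnett's** (HL 2024, Remark 1.3: "instead of (3), the
original conjecture only requires the bound `supₙ |∂gₙ| < ∞`"): on an open `U`, convergence at a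
frequency scale is Burnett convergence — uniform convergence, and on every ball `B ⊆ U` the mean
value inequality turns `‖Dgₙ‖ ≤ C` into a uniform Lipschitz bound.
[cite: HuneauLuk2024wave, Remark 1.3] -/
theorem burnettConverges (h : BurnettConvergesAtScale U g g₀ lam) (hU : IsOpen U) :
    BurnettConverges U g g₀ where
  tendstoLocallyUniformlyOn := h.tendstoUniformlyOn.tendstoLocallyUniformlyOn
  equiLipschitz x hx := by
    obtain ⟨ε, hε, hball⟩ := Metric.isOpen_iff.1 hU x hx
    obtain ⟨C, hC⟩ := h.exists_norm_fderiv_le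
    refine ⟨C.toNNReal, ball x ε, mem_nhdsWithin_of_mem_nhds (ball_mem_nhds x hε), fun n ↦ ?_⟩
    refine (convex_ball x ε).lipschitzOnWith_of_nnnorm_fderiv_le
      (fun y hy ↦ h.differentiableAt hU n (hball hy)) fun y hy ↦ ?_
    rw [← NNReal.coe_le_coe, coe_nnnorm]
    exact (hC n y (hball hy)).trans (Real.le_coe_toNNReal C)

end BurnettConvergesAtScale

end Generic

/-! ### The generalised wave coordinate condition (Huneau–Luk 2024, (1.3)–(1.4)) -/

namespace MetricCoord

variable {E : Type*} [NormedAddCommGroup E] [NormedSpace ℝ E] [FiniteDimensional ℝ E]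
  {ι : Type*} [Fintype ι]

/-- The **contracted Christoffel symbols** ("wave gauge vector") of metric components `G` at `x`
in the basis `b` (the chart): `Hᵏ(x) = (G⁻¹)^{ij}(x) Γᵏ_{ij}(x)` (Huneau–Luk 2024, (1.3):
`H^α ≐ (g⁻¹)^{μν} Γ^α_{μν}(g)`), with `(G⁻¹)^{ij} = ginv G b x i j` and
`Γᵏ_{ij} = bᵏ(chrAt G x bᵢ bⱼ)` from `CoordCurvature.lean`. `H ≡ 0` are wave (harmonic)
coordinates. [cite: HuneauLuk2024wave, (1.3)] -/
def waveGauge (G : E → E →L[ℝ] E →L[ℝ] ℝ) (b : Module.Basis ι ℝ E) (x : E) (k : ι) : ℝ :=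
  ∑ i, ∑ j, ginv G b x i j * b.coord k (chrAt G x (b i) (b j))

/-- Unfolding lemma for `waveGauge`. [cite: HuneauLuk2024wave, (1.3)] -/
theorem waveGauge_apply (G : E → E →L[ℝ] E →L[ℝ] ℝ) (b : Module.Basis ι ℝ E) (x : E) (k : ι) :
    waveGauge G b x k = ∑ i, ∑ j, ginv G b x i j * b.coord k (chrAt G x (b i) (b j)) := rfl

end MetricCoord

section WaveGauge

variable {E : Type*} [NormedAddCommGroup E] [NormedSpace ℝ E] [FiniteDimensional ℝ E]
  {ι : Type*} [Fintype ι]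

/-- The **generalised wave coordinate condition** for the sequence `gₙ` and the limit `g₀` at
scale `λₙ` with exponent `η` (Huneau–Luk 2024, Assumptions 1.2 (4), (1.4)): `η ∈ (0, 1]` and,
with `Hₙ = waveGauge (g n) b`, `H₀ = waveGauge g₀ b` the contracted Christoffel symbols (1.3) in
the chart `b`, uniformly on `U` and in `n`: `|Hₙᵏ − H₀ᵏ| ≲ λₙ^η` and `|∂Hₙᵏ| ≲ 1` for every
component `k`. Classical wave coordinates are the case `Hₙ = H₀ = 0` (HL 2024, Remark 1.6).
[cite: HuneauLuk2024wave, Assumptions 1.2 (4)] -/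
structure WaveCoordinateCondition (b : Module.Basis ι ℝ E) (U : Set E)
    (g : ℕ → E → E →L[ℝ] E →L[ℝ] ℝ) (g₀ : E → E →L[ℝ] E →L[ℝ] ℝ) (lam : ℕ → ℝ) (η : ℝ) :
    Prop where
  /-- `0 < η`. -/
  eta_pos : 0 < η
  /-- `η ≤ 1`. -/
  eta_le_one : η ≤ 1
  /-- (1.4), first half: `|Hₙ − H₀| ≲ λₙ^η` on `U`. -/
  exists_abs_sub_le : ∃ C : ℝ, ∀ n k, ∀ x ∈ U,
    |MetricCoord.waveGauge (g n) b x k - MetricCoord.waveGauge g₀ b x k| ≤ C * lam n ^ η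
  /-- (1.4), second half: `|∂Hₙ| ≲ 1` on `U`. -/
  exists_norm_fderiv_le : ∃ C : ℝ, ∀ n k, ∀ x ∈ U,
    ‖fderiv ℝ (fun y ↦ MetricCoord.waveGauge (g n) b y k) x‖ ≤ C

namespace WaveCoordinateCondition

variable {b : Module.Basis ι ℝ E} {U V : Set E} {g : ℕ → E → E →L[ℝ] E →L[ℝ] ℝ}
  {g₀ : E → E →L[ℝ] E →L[ℝ] ℝ} {lam : ℕ → ℝ} {η : ℝ}

/-- Restriction to a subset. [cite: HuneauLuk2024wave, Assumptions 1.2 (4)] -/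
theorem mono (h : WaveCoordinateCondition b U g g₀ lam η) (hV : V ⊆ U) :
    WaveCoordinateCondition b V g g₀ lam η where
  eta_pos := h.eta_pos
  eta_le_one := h.eta_le_one
  exists_abs_sub_le := by
    obtain ⟨C, hC⟩ := h.exists_abs_sub_le
    exact ⟨C, fun n k x hx ↦ hC n k x (hV hx)⟩
  exists_norm_fderiv_le := by
    obtain ⟨C, hC⟩ := h.exists_norm_fderiv_le
    exact ⟨C, fun n k x hx ↦ hC n k x (hV hx)⟩

/-- Passing to a subsequence. [cite: HuneauLuk2024wave, Assumptions 1.2 (4)] -/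
theorem comp_strictMono (h : WaveCoordinateCondition b U g g₀ lam η) {φ : ℕ → ℕ}
    (_hφ : StrictMono φ) : WaveCoordinateCondition b U (g ∘ φ) g₀ (lam ∘ φ) η where
  eta_pos := h.eta_pos
  eta_le_one := h.eta_le_one
  exists_abs_sub_le := by
    obtain ⟨C, hC⟩ := h.exists_abs_sub_le
    exact ⟨C, fun n k x hx ↦ hC (φ n) k x hx⟩
  exists_norm_fderiv_le := by
    obtain ⟨C, hC⟩ := h.exists_norm_fderiv_le
    exact ⟨C, fun n k x hx ↦ hC (φ n) k x hx⟩

/-- Under a frequency scale the gauge defect tends to `0` uniformly on `U`: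
`sup_U |Hₙᵏ − H₀ᵏ| ≤ C λₙ^η → 0` (HL 2024, (1.4) with `λₙ → 0`, `η > 0`).
[cite: HuneauLuk2024wave, Assumptions 1.2 (4)] -/
theorem tendstoUniformlyOn (h : WaveCoordinateCondition b U g g₀ lam η)
    (hlam : IsFrequencyScale lam) (k : ι) :
    TendstoUniformlyOn (fun n x ↦ MetricCoord.waveGauge (g n) b x k)
      (fun x ↦ MetricCoord.waveGauge g₀ b x k) atTop U := by
  obtain ⟨C, hC⟩ := h.exists_abs_sub_le
  have hpow : Tendsto (fun n ↦ C * lam n ^ η) atTop (𝓝 0) := by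
    have h0 : Tendsto (fun n ↦ lam n ^ η) atTop (𝓝 0) := by
      have := (Real.continuousAt_rpow_const 0 η (Or.inr h.eta_pos.le)).tendsto.comp
        hlam.tendsto_zero
      rw [Real.zero_rpow h.eta_pos.ne'] at this
      exact this
    simpa using h0.const_mul C
  refine Metric.tendstoUniformlyOn_iff.2 fun ε hε ↦ ?_
  filter_upwards [hpow.eventually (gt_mem_nhds hε)] with n hn x hx
  rw [dist_comm, Real.dist_eq]
  exact (hC n k x hx).trans_lt hn

end WaveCoordinateCondition

end WaveGauge

end Literature.Geometry.Lorentzian
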